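import Summits.ValiantsHypothesis.ValiantsHypothesis.Theses.ValuativeGCT
import Literature.Computability.AlgebraicComplexity.DeterminantalConormalBoundProofs

/-!
# `ValuativeGCT.CutBites` (stmt-ValiantsHypothesis-12626), line adjugate-pfaffian-kernel —
# Stub 2 `stub_cofactor_chainRule`

The cofactor chain rule (first half of the contragredient lemma).  Write `G` for the generic
`m × m` matrix in the variables `MatIdx m`, `T_M G` for the matrix with entries
`Σ_l M l (a,b) • X l` (so that `linSubst M det_m = det (T_M G)`), `cof Y = adjugate(Y)ᵀ` and
`T*_M C` for the matrix with entries `Σ_l M (a,b) l • C_l`.  If `M` lies in the abstract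
`End`-stabiliser of `det_m`, i.e. `det (T_M G) = det G` identically (`hM`), then
`T*_M (cof (T_M G)) = cof G`.

Proof: apply the derivation `∂/∂X_l` (`MvPolynomial.pderiv l`) to `det (T_M G) = det G` and use
Jacobi's formula `D (det Y) = tr (adj Y · D Y)` (in tree:
`DeterminantalConormal.derivation_det_eq_trace_adjugate_mul`).  The derivative matrices are the
constant matrices `(M l (a,b))_{ab}` and `E_l`, and the two traces are, entry by entry, the two
sides of the claim.  Downstream the chain rule gives `IsUnit M` (Stub 1), `Mᵀ ∈ Stab` (Stub 3)
and the invariance of the witness `W_m` (Stub 4). [folklore]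
-/

namespace Summit.ValiantsHypothesis.ValiantsHypothesis.Theorems.CutBitesAdjugate

open Literature.NumberTheory.DiophantineGeometry Literature.Computability.AlgebraicComplexity
open MvPolynomial
open scoped BigOperators Matrix

-- `Summit.ValiantsHypothesis.ValiantsHypothesis.…` is the tree's mandated single-conjunct layout (Sub = Summit).
set_option linter.dupNamespace false

/-- Unfolding the stabiliser hypothesis: `linSubst M det_m = det_m` says `det (T_M G) = det G`,
where `G = (X (toLex (a, b)))_{ab}` is the generic matrix (`detFormLex ℂ m = det G` by
`AlgHom.map_det` along `rename toLex`) and `T_M G` has entries `Σ_l M l (a,b) • X l`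
(`AlgHom.map_det` along `linSubst M`, `linSubst_X`). [folklore] -/
theorem cbAdj_det_tmat_eq_det (m : ℕ) (M : Matrix (MatIdx m) (MatIdx m) ℂ)
    (hM : linSubst (MatIdx m) ℂ M (detFormLex ℂ m) = detFormLex ℂ m) :
    (Matrix.of fun a' b' : Fin m => ∑ l' : MatIdx m, M l' (toLex (a', b')) •
        (X l' : MvPolynomial (MatIdx m) ℂ)).det =
      (Matrix.of fun a b : Fin m => (X (toLex (a, b)) : MvPolynomial (MatIdx m) ℂ)).det := by
  have hdet : detFormLex ℂ m =
      (Matrix.of fun a b : Fin m => (X (toLex (a, b)) : MvPolynomial (MatIdx m) ℂ)).det := by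
    rw [detFormLex, detPoly, AlgHom.map_det]
    congr 1
    refine Matrix.ext fun a b => ?_
    simp [Matrix.mvPolynomialX, rename_X]
  have hlin : linSubst (MatIdx m) ℂ M (detFormLex ℂ m) =
      (Matrix.of fun a' b' : Fin m => ∑ l' : MatIdx m, M l' (toLex (a', b')) •
          (X l' : MvPolynomial (MatIdx m) ℂ)).det := by
    rw [hdet, AlgHom.map_det]
    congr 1
    refine Matrix.ext fun a b => ?_
    simp [AlgHom.mapMatrix_apply, linSubst_X]
  rw [← hlin, hM, hdet]

/-- The partial derivative `∂/∂X_l` of the matrix `T_M G` is the constant matrix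
`(M l (a,b))_{ab}`. [folklore] -/
theorem cbAdj_map_pderiv_tmat (m : ℕ) (M : Matrix (MatIdx m) (MatIdx m) ℂ) (l : MatIdx m) :
    (Matrix.of fun a' b' : Fin m => ∑ l' : MatIdx m, M l' (toLex (a', b')) •
          (X l' : MvPolynomial (MatIdx m) ℂ)).map (pderiv l) =
      Matrix.of fun a' b' : Fin m => (C (M l (toLex (a', b'))) : MvPolynomial (MatIdx m) ℂ) := by
  refine Matrix.ext fun a b => ?_
  simp only [Matrix.map_apply, Matrix.of_apply, map_sum, Derivation.map_smul, pderiv_X,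
    Pi.single_apply, smul_ite, smul_zero, Finset.sum_ite_eq', Finset.mem_univ, if_true]
  rw [smul_eq_C_mul, mul_one]

/-- The partial derivative `∂/∂X_l` of the generic matrix `G` is the elementary matrix `E_l`.
[folklore] -/
theorem cbAdj_map_pderiv_genMat (m : ℕ) (l : MatIdx m) :
    (Matrix.of fun a b : Fin m => (X (toLex (a, b)) : MvPolynomial (MatIdx m) ℂ)).map (pderiv l) =
      Matrix.of fun a b : Fin m =>
        if toLex (a, b) = l then (1 : MvPolynomial (MatIdx m) ℂ) else 0 := by
  refine Matrix.ext fun a b => ?_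
  simp only [Matrix.map_apply, Matrix.of_apply, pderiv_X, Pi.single_apply]

/-- **Stub 2 — the cofactor chain rule** (Jacobi): if `det (T_M Y) = det Y` identically
(`linSubst M det_m = det_m`, `(T_M Y)_{ab} = Σ_l M l (a,b) • Y_l`), then
`T*_M (cof (T_M Y)) = cof Y` identically, `(T*_M C)_{ab} = Σ_l M (a,b) l • C_l`; obtained by
applying `∂/∂Y_l` to `det (T_M Y) = det Y` and Jacobi's formula
`D (det Y) = tr (adj Y · D Y)`. [folklore] -/
theorem stub_cofactor_chainRule (m : ℕ) (M : Matrix (MatIdx m) (MatIdx m) ℂ)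
    (hM : linSubst (MatIdx m) ℂ M (detFormLex ℂ m) = detFormLex ℂ m) :
    (Matrix.of fun a b : Fin m => ∑ l : MatIdx m, M (toLex (a, b)) l •
        (Matrix.of fun a' b' : Fin m => ∑ l' : MatIdx m, M l' (toLex (a', b')) •
          (X l' : MvPolynomial (MatIdx m) ℂ)).adjugateᵀ (ofLex l).1 (ofLex l).2)
      = (Matrix.of fun a b : Fin m => (X (toLex (a, b)) : MvPolynomial (MatIdx m) ℂ)).adjugateᵀ := by
  have hTG := cbAdj_det_tmat_eq_det m M hM
  set T : Matrix (Fin m) (Fin m) (MvPolynomial (MatIdx m) ℂ) :=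
    Matrix.of fun a' b' : Fin m => ∑ l' : MatIdx m, M l' (toLex (a', b')) •
      (X l' : MvPolynomial (MatIdx m) ℂ) with hT
  set G : Matrix (Fin m) (Fin m) (MvPolynomial (MatIdx m) ℂ) :=
    Matrix.of fun a b : Fin m => (X (toLex (a, b)) : MvPolynomial (MatIdx m) ℂ) with hG
  ext a₀ b₀
  -- differentiate `det T = det G` with respect to `X (toLex (a₀, b₀))`
  have hD := congrArg
    (pderiv (toLex (a₀, b₀)) : MvPolynomial (MatIdx m) ℂ → MvPolynomial (MatIdx m) ℂ) hTG
  rw [DeterminantalConormal.derivation_det_eq_trace_adjugate_mul,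
    DeterminantalConormal.derivation_det_eq_trace_adjugate_mul, hT, cbAdj_map_pderiv_tmat, ← hT,
    hG, cbAdj_map_pderiv_genMat, ← hG] at hD
  -- the right trace is `(cof G) a₀ b₀`
  have hR : (G.adjugate * Matrix.of fun a b : Fin m =>
      if toLex (a, b) = toLex (a₀, b₀) then (1 : MvPolynomial (MatIdx m) ℂ) else 0).trace
        = G.adjugateᵀ a₀ b₀ := by
    simp only [Matrix.trace, Matrix.diag_apply, Matrix.mul_apply, Matrix.of_apply,
      EmbeddingLike.apply_eq_iff_eq, Prod.mk.injEq, mul_ite, mul_one, mul_zero, ite_and,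
      Finset.sum_ite_eq', Finset.mem_univ, if_true, Matrix.transpose_apply]
  -- the left trace is `(T*_M (cof T)) a₀ b₀`
  have hL : (T.adjugate * Matrix.of fun a' b' : Fin m =>
      (C (M (toLex (a₀, b₀)) (toLex (a', b'))) : MvPolynomial (MatIdx m) ℂ)).trace
        = ∑ l : MatIdx m, M (toLex (a₀, b₀)) l • T.adjugateᵀ (ofLex l).1 (ofLex l).2 := by
    simp only [Matrix.trace, Matrix.diag_apply, Matrix.mul_apply, Matrix.of_apply,
      Matrix.transpose_apply]
    rw [← Equiv.sum_comp (toLex : Fin m × Fin m ≃ MatIdx m), Fintype.sum_prod_type_right]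
    refine Finset.sum_congr rfl fun a _ => Finset.sum_congr rfl fun b _ => ?_
    simp only [ofLex_toLex, smul_eq_C_mul]
    exact mul_comm _ _
  rw [hL, hR] at hD
  rw [← hD, Matrix.of_apply]

end Summit.ValiantsHypothesis.ValiantsHypothesis.Theorems.CutBitesAdjugate
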